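import Summits.ValiantsHypothesis.ValiantsHypothesis.Theorems.PrincipalMinorColouringTotalRankSuperlinear

/-!
# Route PrincipalMinorColouring — `ExcessRankUnbounded` (stmt-ValiantsHypothesis-3783) from
# `TotalRankSuperlinear`

The support item `ExcessRankUnbounded` («for every `k` and all large `n`, `per_n(x+J)/n!` has no
principal-minor representation of total rank `R ≤ n² + k`») is the weakest rung of the route's ladder;
it follows at once from the crux `TotalRankSuperlinear` (PROVED in
`PrincipalMinorColouringTotalRankSuperlinear.lean` from Hrubeš–Joglekar 2025, Thm. 7): `R ≥ n^(2+ε)`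
and `n^(2+ε) = n² · n^ε > n² (k+1) ≥ n² + k` once `n > (k+1)^{1/ε}`, `n ≥ 1`. Honest framing:
bookkeeping over a published bound; nothing here is progress on `VP ≠ VNP`.
-/

set_option linter.dupNamespace false

namespace Summit.ValiantsHypothesis.ValiantsHypothesis.Theorems.PrincipalMinorColouring

open Summit.ValiantsHypothesis.ValiantsHypothesis.Theses.PrincipalMinorColouring

/-- **Item `ExcessRankUnbounded` (stmt-ValiantsHypothesis-3783), PROVED** from `TotalRankSuperlinear`.
[cite: HrubesJoglekar2025, Thm. 7] -/
theorem excessRankUnbounded_proof : ExcessRankUnbounded := by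
  obtain ⟨ε, hε, n₁, h⟩ := totalRankSuperlinear_proof
  intro k
  refine ⟨max n₁ (⌈((k : ℝ) + 1) ^ (1 / ε)⌉₊ + 1), fun n hn R hR hex => ?_⟩
  obtain ⟨K, κ, hrep⟩ := hex
  have hn₁ : n₁ ≤ n := le_trans (le_max_left _ _) hn
  have hceil : ⌈((k : ℝ) + 1) ^ (1 / ε)⌉₊ < n :=
    lt_of_lt_of_le (Nat.lt_succ_self _) (le_trans (le_max_right _ _) hn)
  have hnt : ((k : ℝ) + 1) ^ (1 / ε) < n := Nat.lt_of_ceil_lt hceil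
  have hn1 : (1 : ℝ) ≤ n := by
    have : 1 ≤ n := le_trans (Nat.succ_le_succ (Nat.zero_le _)) (le_trans (le_max_right _ _) hn)
    exact_mod_cast this
  have hnpos : (0 : ℝ) < n := lt_of_lt_of_le one_pos hn1
  have hk1 : (0 : ℝ) ≤ (k : ℝ) + 1 := by positivity
  -- `n ^ ε > k + 1`
  have hpow : (k : ℝ) + 1 < (n : ℝ) ^ ε := by
    have h1 : (((k : ℝ) + 1) ^ (1 / ε)) ^ ε < (n : ℝ) ^ ε :=
      Real.rpow_lt_rpow (Real.rpow_nonneg hk1 _) hnt hε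
    rwa [← Real.rpow_mul hk1, one_div_mul_cancel hε.ne', Real.rpow_one] at h1
  -- the bound of the crux
  have hle : (n : ℝ) ^ (2 + ε) ≤ R := h n hn₁ R K κ hrep
  have hR : (R : ℝ) ≤ (n : ℝ) ^ 2 + k := by exact_mod_cast hR
  have hsplit : (n : ℝ) ^ (2 + ε) = (n : ℝ) ^ 2 * (n : ℝ) ^ ε := by
    rw [Real.rpow_add hnpos, Real.rpow_two]
  have hsq : (1 : ℝ) ≤ (n : ℝ) ^ 2 := by nlinarith
  have : (n : ℝ) ^ 2 + k < (n : ℝ) ^ (2 + ε) := by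
    rw [hsplit]
    nlinarith [mul_lt_mul_of_pos_left hpow (lt_of_lt_of_le one_pos hsq)]
  linarith

end Summit.ValiantsHypothesis.ValiantsHypothesis.Theorems.PrincipalMinorColouring
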